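import Mathlib.Analysis.InnerProductSpace.Projection.Basic
import Mathlib.Analysis.InnerProductSpace.Symmetric
import HarnessLib

/-!
# Leakage of an eigenvector into a trial subspace (block identity behind the `sin Θ` theorems)

Topic `Literature/Analysis/InnerProduct` (next to `WeinsteinBound`, `CourantFischerBounds`).
Setting: an inner product space `E`; a linear map `T` (no symmetry needed for the leakage bound);
an eigenvector `T u = ε u` split as `u = v + w` with `⟪v, w⟫ = 0` (in the applications
`v = P_V u`, `w = u − P_V u` for a subspace `V` with an orthogonal projection).

* `sub_mul_norm_sq_le_of_eigenvector` — THE LEAKAGE (FESHBACH / `sin Θ` BLOCK) INEQUALITY: if the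
  form of `T` is bounded below by `m` on `v` (`m ‖v‖² ≤ ⟪T v, v⟫`) and the coupling is bounded by
  `η` (`|⟪T w, v⟫| ≤ η ‖w‖ ‖v‖`) then `(m − ε) ‖v‖² ≤ η ‖w‖ ‖v‖`; proof: pair `T u = ε u` with `v`.
  This is the one-line block identity `E₂₁ = Q₂ᵀ A Q₁` / `(D₁ − λ) p = …` that opens the proofs of the
  invariant-subspace perturbation theorems (Golub–Van Loan, *Matrix Computations* 4th ed., §8.1.3,
  Thm 8.1.10–8.1.12; Davis–Kahan 1970, the `sin Θ` theorem); we record only this elementary half,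
  which needs neither symmetry nor finite dimension.
* `norm_le_div_of_eigenvector` — the divided form `‖v‖ ≤ η ‖w‖ / (m − ε)` for `ε < m`, `0 ≤ η`.
* `starProjection_leakage`, `norm_starProjection_le_div_of_eigenvector` — the same with
  `v = P_V u`, `w = u − P_V u` for a subspace `V` carrying Mathlib's `Submodule.starProjection`:
  an eigenvector with eigenvalue `ε` below the form floor `m` of `T` on `V` has component in `V` of
  norm at most `η / (m − ε)` (unit `u`), `η` = the norm of the off-diagonal block `P_V^⊥ T P_V`.
* `norm_starProjection_le_opNorm_sub_of_mem_orthogonal` — TRANSFER OF ORTHOGONALITY: if `u ⊥ U` then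
  `‖P_V u‖ ≤ ‖P_V − P_U‖ ‖u‖` (`‖P_V − P_U‖ = sin Θ_max(U, V)` for equidimensional subspaces,
  Golub–Van Loan §2.5.3 / §6.4.3); so a vector exactly orthogonal to `U` is orthogonal to any `V` close to `U`
  up to the gap between the subspaces.
* `inner_eq_zero_of_eigenvector_ne` — eigenvectors of a symmetric operator with distinct (real)
  eigenvalues are orthogonal (the vector form of Mathlib's
  `LinearMap.IsSymmetric.orthogonalFamily_eigenspaces`).

Motivation (pub-rhpf cell, THEORY-3 "intruder ⟂ transported prolate span"; mechanism/rigidity campaign,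
no RH claims): these are the three STRUCTURAL facts that make "the crossing eigenvector is orthogonal to the
span of the other low modes" a theorem for ANY symmetric window matrix, and that bound its component in an
a-priori (archimedean) trial span by coupling/gap. Everything here is abstract linear algebra; no definitions,
no named facts; sorry-free.

## References
* G. H. Golub, C. F. Van Loan, *Matrix Computations*, 4th ed. (2013), §8.1.3 Thm 8.1.10, Cor 8.1.11, Thm 8.1.12. [GolubVanLoan2013]
* C. Davis, W. M. Kahan, The rotation of eigenvectors by a perturbation III, SIAM J. Numer. Anal. 7 (1970) 1–46. [DavisKahan1970]
-/

noncomputable section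

open scoped InnerProductSpace

namespace Literature.Analysis.InnerProduct

section Leakage

variable {E : Type*} [NormedAddCommGroup E] [InnerProductSpace ℝ E]

/-- **Leakage (block) inequality.** `T u = ε u`, `v + w = u`, `⟪v, w⟫ = 0`, form floor `m` on `v` and
coupling bound `η` give `(m − ε) ‖v‖² ≤ η ‖w‖ ‖v‖`. No symmetry of `T` is used.
[cite: GolubVanLoan2013, Thm 8.1.10] -/
theorem sub_mul_norm_sq_le_of_eigenvector {T : E →ₗ[ℝ] E} {u v w : E} {ε m η : ℝ}
    (hu : T u = ε • u) (hsum : v + w = u) (hvw : ⟪v, w⟫_ℝ = 0)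
    (hgap : m * ‖v‖ ^ 2 ≤ ⟪T v, v⟫_ℝ) (hcoup : |⟪T w, v⟫_ℝ| ≤ η * ‖w‖ * ‖v‖) :
    (m - ε) * ‖v‖ ^ 2 ≤ η * ‖w‖ * ‖v‖ := by
  have hwv : ⟪w, v⟫_ℝ = 0 := by rw [real_inner_comm]; exact hvw
  have e1 : ⟪T u, v⟫_ℝ = ε * ‖v‖ ^ 2 := by
    rw [hu, real_inner_smul_left, ← hsum, inner_add_left, real_inner_self_eq_norm_sq, hwv, add_zero]
  have e2 : ⟪T u, v⟫_ℝ = ⟪T v, v⟫_ℝ + ⟪T w, v⟫_ℝ := by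
    rw [← hsum, map_add, inner_add_left]
  have h3 : -⟪T w, v⟫_ℝ ≤ |⟪T w, v⟫_ℝ| := neg_le_abs _
  have key : m * ‖v‖ ^ 2 ≤ ε * ‖v‖ ^ 2 + η * ‖w‖ * ‖v‖ := by linarith
  rw [sub_mul]
  linarith

/-- **Leakage inequality, divided form.** With `ε < m` and `0 ≤ η`: `‖v‖ ≤ η ‖w‖ / (m − ε)`.
[cite: GolubVanLoan2013, Thm 8.1.12] -/
theorem norm_le_div_of_eigenvector {T : E →ₗ[ℝ] E} {u v w : E} {ε m η : ℝ}
    (hu : T u = ε • u) (hsum : v + w = u) (hvw : ⟪v, w⟫_ℝ = 0)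
    (hgap : m * ‖v‖ ^ 2 ≤ ⟪T v, v⟫_ℝ) (hcoup : |⟪T w, v⟫_ℝ| ≤ η * ‖w‖ * ‖v‖)
    (hm : ε < m) (hη : 0 ≤ η) :
    ‖v‖ ≤ η * ‖w‖ / (m - ε) := by
  have h := sub_mul_norm_sq_le_of_eigenvector hu hsum hvw hgap hcoup
  have hmε : 0 < m - ε := sub_pos.mpr hm
  rw [le_div_iff₀ hmε]
  by_cases hv : ‖v‖ = 0
  · rw [hv, zero_mul]; positivity
  · have hvpos : 0 < ‖v‖ := lt_of_le_of_ne (norm_nonneg _) (Ne.symm hv)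
    have h' : ((m - ε) * ‖v‖) * ‖v‖ ≤ (η * ‖w‖) * ‖v‖ := by
      have : (m - ε) * ‖v‖ ^ 2 = ((m - ε) * ‖v‖) * ‖v‖ := by ring
      linarith
    have h'' : (m - ε) * ‖v‖ ≤ η * ‖w‖ := le_of_mul_le_mul_right h' hvpos
    linarith

/-- **Leakage into a trial subspace.** For a subspace `V` with orthogonal projection `P_V`, an
eigenvector `T u = ε u`, a form floor `m` of `T` on `V` and a coupling bound `η` between `V` and `Vᗮ`:
`(m − ε) ‖P_V u‖² ≤ η ‖u − P_V u‖ ‖P_V u‖`. [cite: GolubVanLoan2013, Thm 8.1.10] -/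
theorem starProjection_leakage (V : Submodule ℝ E) [V.HasOrthogonalProjection]
    {T : E →ₗ[ℝ] E} {u : E} {ε m η : ℝ} (hu : T u = ε • u)
    (hgap : ∀ v ∈ V, m * ‖v‖ ^ 2 ≤ ⟪T v, v⟫_ℝ)
    (hcoup : ∀ v ∈ V, ∀ w ∈ Vᗮ, |⟪T w, v⟫_ℝ| ≤ η * ‖w‖ * ‖v‖) :
    (m - ε) * ‖V.starProjection u‖ ^ 2 ≤
      η * ‖u - V.starProjection u‖ * ‖V.starProjection u‖ := by
  have hvw : ⟪V.starProjection u, u - V.starProjection u⟫_ℝ = 0 := by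
    rw [real_inner_comm]
    exact V.starProjection_inner_eq_zero u _ (V.starProjection_apply_mem u)
  exact sub_mul_norm_sq_le_of_eigenvector hu (by abel) hvw
    (hgap _ (V.starProjection_apply_mem u))
    (hcoup _ (V.starProjection_apply_mem u) _ (V.sub_starProjection_mem_orthogonal u))

/-- **Leakage into a trial subspace, unit-vector form.** If moreover `ε < m`, `0 ≤ η` and `‖u‖ = 1`
then `‖P_V u‖ ≤ η / (m − ε)`: an eigenvector whose eigenvalue lies below the form floor of `T` on `V`
(by the gap `m − ε`) has component in `V` at most coupling/gap. [cite: GolubVanLoan2013, Thm 8.1.12] -/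
theorem norm_starProjection_le_div_of_eigenvector (V : Submodule ℝ E) [V.HasOrthogonalProjection]
    {T : E →ₗ[ℝ] E} {u : E} {ε m η : ℝ} (hu : T u = ε • u)
    (hgap : ∀ v ∈ V, m * ‖v‖ ^ 2 ≤ ⟪T v, v⟫_ℝ)
    (hcoup : ∀ v ∈ V, ∀ w ∈ Vᗮ, |⟪T w, v⟫_ℝ| ≤ η * ‖w‖ * ‖v‖)
    (hm : ε < m) (hη : 0 ≤ η) (hun : ‖u‖ = 1) :
    ‖V.starProjection u‖ ≤ η / (m - ε) := by
  have hvw : ⟪V.starProjection u, u - V.starProjection u⟫_ℝ = 0 := by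
    rw [real_inner_comm]
    exact V.starProjection_inner_eq_zero u _ (V.starProjection_apply_mem u)
  have h := norm_le_div_of_eigenvector hu (by abel) hvw
    (hgap _ (V.starProjection_apply_mem u))
    (hcoup _ (V.starProjection_apply_mem u) _ (V.sub_starProjection_mem_orthogonal u)) hm hη
  have hw : ‖u - V.starProjection u‖ ≤ 1 := by
    rw [← V.starProjection_orthogonal_val u, ← hun]
    exact Vᗮ.norm_starProjection_apply_le u
  calc ‖V.starProjection u‖ ≤ η * ‖u - V.starProjection u‖ / (m - ε) := h
    _ ≤ η * 1 / (m - ε) := by gcongr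
    _ = η / (m - ε) := by rw [mul_one]

end Leakage

section Transfer

variable {𝕜 : Type*} [RCLike 𝕜] {E : Type*} [NormedAddCommGroup E] [InnerProductSpace 𝕜 E]

/-- **Transfer of orthogonality between nearby subspaces.** If `u ⊥ U` then
`‖P_V u‖ ≤ ‖P_V − P_U‖ ‖u‖`; for subspaces of equal finite dimension `‖P_V − P_U‖` is the sine of the
largest principal angle between `U` and `V`. [cite: GolubVanLoan2013, Cor 8.1.11] -/
theorem norm_starProjection_le_opNorm_sub_of_mem_orthogonal (U V : Submodule 𝕜 E)
    [U.HasOrthogonalProjection] [V.HasOrthogonalProjection] {u : E} (hu : u ∈ Uᗮ) :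
    ‖V.starProjection u‖ ≤ ‖V.starProjection - U.starProjection‖ * ‖u‖ := by
  have h0 : U.starProjection u = 0 := U.starProjection_apply_eq_zero_iff.mpr hu
  have h1 : V.starProjection u = (V.starProjection - U.starProjection) u := by
    simp only [FunLike.coe_sub, Pi.sub_apply, h0, sub_zero]
  rw [h1]
  exact ContinuousLinearMap.le_opNorm _ _

/-- **Eigenvectors of a symmetric operator with distinct eigenvalues are orthogonal** (vector form of
Mathlib's `LinearMap.IsSymmetric.orthogonalFamily_eigenspaces`; eigenvalues of a symmetric operator are
real, so they are taken in `ℝ`). [folklore] -/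
theorem inner_eq_zero_of_eigenvector_ne {T : E →ₗ[𝕜] E} (hT : T.IsSymmetric) {u v : E} {μ ν : ℝ}
    (hu : T u = (μ : 𝕜) • u) (hv : T v = (ν : 𝕜) • v) (hne : μ ≠ ν) : ⟪u, v⟫_𝕜 = 0 := by
  have h1 : ⟪T u, v⟫_𝕜 = ⟪u, T v⟫_𝕜 := hT u v
  rw [hu, hv, inner_smul_left, inner_smul_right, RCLike.conj_ofReal] at h1
  have h2 : ((μ : 𝕜) - (ν : 𝕜)) * ⟪u, v⟫_𝕜 = 0 := by rw [sub_mul]; exact sub_eq_zero.mpr h1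
  rcases mul_eq_zero.mp h2 with h | h
  · exact absurd (by exact_mod_cast sub_eq_zero.mp h) hne
  · exact h

end Transfer

end Literature.Analysis.InnerProduct

end
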